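import Summits.BirchSwinnertonDyer.BirchSwinnertonDyer.Theorems.CumulativeHeegnerLeopoldtEisensteinCharacterInvariantsAtThreeOfUnitCoeffLeLambda
import Summits.BirchSwinnertonDyer.BirchSwinnertonDyer.Theorems.EisensteinPrimesGoodLatticeOmegaPrelims
import Summits.BirchSwinnertonDyer.Rank1Residual.Partition.AnticyclotomicControlJSWEmbAt
import Summits.BirchSwinnertonDyer.Rank1Residual.X11b.Three.StepLAtThree
import HarnessLib

/-!
# Route `CumulativeHeegnerLeopoldt`, crux K2 `EisensteinCharacterInvariantsAtThree` (stmt-BirchSwinnertonDyer-24199):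
# K2′ (at odd `d_K`) CUT THROUGH THE TWO CHARACTERS OF `E[3]^{ss}` — the Eisenstein-congruence composition
# «[ALG] + [AN] + [BR] (+ [LOC₃], [TOR]) ⟹ K2′» in the kernel, in the `bsd-eis` vocabulary (HELPER, `--supports 24199`)

Lead prover `bsd-line-chl-p1` g8. Companion of the g7 helpers (`…OfUnitCoeffLeLambda`: under B1 ∧ K1, K2 ↔ K2′ :=
«at every frame some `n ≤ λ(X_{∅,0}(𝔭′))` has `‖L_n‖ = 1`») and of the memo `K2PRIME-ROAD-chl-p1-g8.md`
(evidence on 24199). WHAT THIS FILE PROVES (one theorem, `unitCoeffLe_odd_of_characterCut`): K2′ with the extra binder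
`Odd (NumberField.discr K)` (the scope in which the tree's Hida / Rubin facts are typed; the route kernel♯ applies K2 only
after deriving `Odd (discr K)` at its Friedberg–Hoffstein field) FOLLOWS from five displayed statements about the wild
non-anomalous cell at `p = 3` and two CHARACTER-LEVEL statements of the `EisensteinPrimes` (K5) lineage, reused BY NAME:

* [ALG]  (`halg`)  — Castella–Grossi–Lee–Skinner 2022 Thm. 1.5.1 SHAPE on the cell: `μ(𝔛) = 0` and
  `λ(𝔛) + Σ_{w∣N} λ𝒫_w(f) = λ(𝔛_{θsub}) + λ(𝔛_{θquot}) + Σ_{w∣N}(λ𝒫_w(θsub) + λ𝒫_w(θquot))` for `𝔛 = X_{∅,0}(𝔭′)` and the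
  residual pair `(θsub, θquot)` of `E[3](K̄)` (printed at good `p`; its printed proof uses good reduction only through
  `E(K_w)[p] = 0`, i.e. the non-anomalous hypothesis — a PORT, containing the K1 line's stub B1);
* [AN]   (`han`)   — the ADDITIVE twin of the tree fact `KellerYin2024.thm222_anacong_goodLattice_of_ne_one` (CGLS Thms.
  2.2.1/2.2.2 with (2.16)): `μ(L) = 0` and `λ(L) + Σ λ𝒫_w(f) = 2·λ(L_φ) + Σ(…)`, `φ` := the 3-UNRAMIFIED member of the pair,
  `L_φ` any Katz frame of its Hecke character — NOT PRINTED at `27 ∣ N` (the ONE research statement of the cut: the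
  Λ-adic Eisenstein congruence on the Igusa tower of tame level `N/3^a`);
* [BRram] (`hram`) — the one-variable main conjecture at the 3-RAMIFIED member read through the functional equation:
  `λ(𝔛_{θram}) = λ(L_φ)`, `μ = 0` (CGLS Thm. 1.2.2 = Rubin 1991 + Hida 2010, with (2.16); character-level);
* [LOC₃] (`hloc`)  — at `p = 3` one member of the Teichmüller pair of a rational 3-line is UNRAMIFIED at 3 (elementary:
  both characters are quadratic with product `ω`, and `I_3` has a unique quadratic character);
* [TOR]  (`htor`)  — `E(K)[3] = 0` on the cell for `K` with a degree-one prime above 3 (the decomposition group at a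
  prime of `ℚ̄` over it lies in `Γ_K` and fixes no point of `Φ` nor of `E[3]/Φ`);
* [BR𝟙] (`hbr`) = `X1.KellerYinMuLambdaSplit.CharMainConjOnTree 3` and [F1b] (`hF1`) =
  `X1.KellerYinMuLambdaSplit.KatzLFunctionExistsFor 3` — the K5 line's character-level shapes, VERBATIM.

The proof is Keller–Yin's assembly (arXiv:2402.12781v2 L1631–1640) as landed for K5 in
`EisensteinPrimesMuLambda.goodLatticeMuLambdaOnTree_of_split`, transplanted: the Teichmüller pair of `G_ℚ` is CONSTRUCTED
(`EisensteinPrimesMuLambda.exists_teichmullerPair`), restricted to `Γ_K` (`isResidualPairOver_restrictField`), shown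
unramified off `N` (Néron–Ogg–Shafarevich, `isUnramifiedAt_of_isTeichmullerLiftOn[Quot]`); [LOC₃] picks the unramified
member `θunr`; Artin reciprocity gives its Hecke character (`exists_heckeCharacter_of_pow_eq_one`), [F1b] its Katz frame;
[BR𝟙] gives `λ(𝔛_{θunr}) = λ(L_φ) + e`, `e ∈ {0,1}`; [BRram] gives `λ(𝔛_{θram}) = λ(L_φ)`; [ALG] and [AN] then force
`λ(𝔛) = λ(L) + e ≥ λ(L)` (the local sums CANCEL), which is K2′ at that frame. CONDITIONAL on the seven displayed
hypotheses (nothing is asserted about any of them; [AN] is research, [ALG]/[BRram]/[BR𝟙] are print-modulo-port resp.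
the K5 lineage's typed shapes, [LOC₃]/[TOR] elementary); closes nothing; THEOREMS ONLY (no `def`, no `sorry`).
BSD is not proved for any curve by any of this.

References: [CastellaGrossiLeeSkinner2022] Thms. 1.2.2, 1.5.1, 2.1.2, 2.2.1–2.2.4 (arXiv:2008.02571v2);
[KellerYin2024] Thm. 1.5.1, Thms. 2.2.1–2.2.3, proof of Thm. 3.0.8 (L1631–1640); [Rubin1991] Thm. 4.1;
[Hida2010MuInvariant] Thm. I; [Kriz2016] Thms. 27, 34, 35, Prop. 37; HOME/bsd-line-chl-p1/K2PRIME-ROAD-chl-p1-g8.md.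
-/

set_option autoImplicit false
set_option linter.dupNamespace false

noncomputable section

open scoped Classical

namespace Summit.BirchSwinnertonDyer.BirchSwinnertonDyer.Theorems.EisensteinCharacterInvariantsAtThreeCharacterCut

open PowerSeries WeierstrassCurve NumberField IsDedekindDomain Field
  Literature.NumberTheory.EllipticCurves Literature.NumberTheory.EllipticCurves.ModularForms
  Literature.NumberTheory.EllipticCurves.Rank1Residual
  Literature.NumberTheory.EllipticCurves.KellerYin2024
  Literature.NumberTheory.GaloisRepresentations
  Summit.BirchSwinnertonDyer.Rank1Residual
  Summit.BirchSwinnertonDyer.Rank1Residual.X1.KellerYinMuLambdaSplit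
  Summit.BirchSwinnertonDyer.BirchSwinnertonDyer.Theorems.EisensteinPrimesMuLambda

/-- **K2′ at odd `d_K` from the character cut.** Displayed hypotheses (binder types spelled in full; see the module
docstring for their print status): `htor` [TOR], `hloc` [LOC₃], `halg` [ALG] (CGLS Thm. 1.5.1 shape on the cell),
`han` [AN] (additive twin of `KellerYin2024.thm222_anacong_goodLattice_of_ne_one` — research), `hram` [BRram],
`hbr` = `CharMainConjOnTree 3`, `hF1` = `KatzLFunctionExistsFor 3`. Conclusion: the statement K2′ of
`EisensteinCharacterInvariantsAtThreeReshape.eisensteinCharacterInvariantsAtThree_iff_unitCoeffLe` with ONE extra binder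
`Odd (NumberField.discr K)`: at every BDP frame `L` of the cell, `∃ n ≤ λ(X_{∅,0}(𝔭′))` with `‖L_n‖ = 1`.
Proof = Keller–Yin's assembly (the K5 kernel theorem `goodLatticeMuLambdaOnTree_of_split`, transplanted), the local
sums cancelling in `ℕ` (`omega`). CONDITIONAL; closes nothing.
[cite: KellerYin2024, proof of Thm. 3.0.8 (arXiv:2402.12781v2 TeX L1631–1640) and proof of Thm. 2.2.3 (L1455–1467)]
[cite: CastellaGrossiLeeSkinner2022, Thm. 1.5.1, Thm. 2.2.2 with (2.16), Thm. 2.2.4] -/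
theorem unitCoeffLe_odd_of_characterCut
    (htor : ∀ (W : WeierstrassCurve ℚ) [W.IsElliptic] [W.IsGloballyMinimal] (N : ℕ) [NeZero N] (K : Type) [Field K] [NumberField K], Summit.BirchSwinnertonDyer.Rank1Residual.Additive.ClassO6 W 3 → Literature.NumberTheory.EllipticCurves.Rank1Residual.Red W 3 → (∃ Φ : AddSubgroup (WeierstrassCurve.geomTorsion W ((3 : ℕ) : ℤ)), Literature.NumberTheory.EllipticCurves.Rank1Residual.IsRationalLine W 3 Φ ∧ ∀ (v : IsDedekindDomain.HeightOneSpectrum (NumberField.RingOfIntegers ℚ)), ((3 : ℕ) : NumberField.RingOfIntegers ℚ) ∈ v.asIdeal → ∀ 𝔓 ∈ v.primesAbove, ¬ (∀ g ∈ 𝔓.decompositionSubgroup (Field.absoluteGaloisGroup ℚ), ∀ P ∈ Φ, g • P = P) ∧ ¬ (∀ g ∈ 𝔓.decompositionSubgroup (Field.absoluteGaloisGroup ℚ), ∀ P : WeierstrassCurve.geomTorsion W ((3 : ℕ) : ℤ), g • P - P ∈ Φ)) → W.conductorNorm ℤ = N → Literature.NumberTheory.EllipticCurves.IsImaginaryQuadratic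 K → Literature.NumberTheory.EllipticCurves.SatisfiesHeegnerHypothesis N K → ∀ (𝔭 : IsDedekindDomain.HeightOneSpectrum (NumberField.RingOfIntegers K)), ((3 : ℕ) : NumberField.RingOfIntegers K) ∈ 𝔭.asIdeal → 𝔭.asIdeal.ramificationIdx (NumberField.RingOfIntegers ℚ) = 1 → 𝔭.asIdeal.inertiaDeg (NumberField.RingOfIntegers ℚ) = 1 → ∀ Q : (W.baseChange K).toAffine.Point, (3 : ℕ) • Q = 0 → Q = 0)
    (hloc : ∀ (W : WeierstrassCurve ℚ) [W.IsElliptic] [W.IsGloballyMinimal], Summit.BirchSwinnertonDyer.Rank1Residual.Additive.ClassO6 W 3 → Literature.NumberTheory.EllipticCurves.Rank1Residual.Red W 3 → (∃ Φ : AddSubgroup (WeierstrassCurve.geomTorsion W ((3 : ℕ) : ℤ)), Literature.NumberTheory.EllipticCurves.Rank1Residual.IsRationalLine W 3 Φ ∧ ∀ (v : IsDedekindDomain.HeightOneSpectrum (NumberField.RingOfIntegers ℚ)), ((3 : ℕ) : NumberField.RingOfIntegers ℚ) ∈ v.asIdeal → ∀ 𝔓 ∈ v.primesAbove, ¬ (∀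 g ∈ 𝔓.decompositionSubgroup (Field.absoluteGaloisGroup ℚ), ∀ P ∈ Φ, g • P = P) ∧ ¬ (∀ g ∈ 𝔓.decompositionSubgroup (Field.absoluteGaloisGroup ℚ), ∀ P : WeierstrassCurve.geomTorsion W ((3 : ℕ) : ℤ), g • P - P ∈ Φ)) → ∀ (Φ : AddSubgroup (WeierstrassCurve.geomTorsion W ((3 : ℕ) : ℤ))), Literature.NumberTheory.EllipticCurves.Rank1Residual.IsRationalLine W 3 Φ → ∀ (θsub θquot : FramedGaloisRep ℚ (padicCoeffIntegers (∅ : Set (PadicAlgCl 3))) 1), Literature.NumberTheory.EllipticCurves.KellerYin2024.IsTeichmullerLiftOn (∅ : Set (PadicAlgCl 3)) (Φ.map (WeierstrassCurve.geomTorsion W ((3 : ℕ) : ℤ)).subtype) θsub → Literature.NumberTheory.EllipticCurves.KellerYin2024.IsTeichmullerLiftOnQuot (∅ : Set (PadicAlgCl 3)) (Φ.map (WeierstrassCurve.geomTorsion W ((3 : ℕ) : ℤ)).subtype) (WeierstrassCurve.geomTorsion W ((3 : ℕ) : ℤ)) θquot → (∀ u : IsDedekindDomain.HeightOneSpectrum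 (NumberField.RingOfIntegers ℚ), ((3 : ℕ) : NumberField.RingOfIntegers ℚ) ∈ u.asIdeal → θsub.IsUnramifiedAt u) ∨ (∀ u : IsDedekindDomain.HeightOneSpectrum (NumberField.RingOfIntegers ℚ), ((3 : ℕ) : NumberField.RingOfIntegers ℚ) ∈ u.asIdeal → θquot.IsUnramifiedAt u))
    (halg : ∀ (W : WeierstrassCurve ℚ) [W.IsElliptic] [W.IsGloballyMinimal] (N : ℕ) [NeZero N] (K : Type) [Field K] [NumberField K], Summit.BirchSwinnertonDyer.Rank1Residual.Additive.ClassO6 W 3 → Literature.NumberTheory.EllipticCurves.Rank1Residual.Red W 3 → (∃ Φ : AddSubgroup (WeierstrassCurve.geomTorsion W ((3 : ℕ) : ℤ)), Literature.NumberTheory.EllipticCurves.Rank1Residual.IsRationalLine W 3 Φ ∧ ∀ (v : IsDedekindDomain.HeightOneSpectrum (NumberField.RingOfIntegers ℚ)), ((3 : ℕ) : NumberField.RingOfIntegers ℚ) ∈ v.asIdeal → ∀ 𝔓 ∈ v.primesAbove, ¬ (∀ g ∈ 𝔓.decompositionSubgroup (Field.absoluteGaloisGroup ℚ), ∀ P ∈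 Φ, g • P = P) ∧ ¬ (∀ g ∈ 𝔓.decompositionSubgroup (Field.absoluteGaloisGroup ℚ), ∀ P : WeierstrassCurve.geomTorsion W ((3 : ℕ) : ℤ), g • P - P ∈ Φ)) → W.conductorNorm ℤ = N → Literature.NumberTheory.EllipticCurves.IsImaginaryQuadratic K → Literature.NumberTheory.EllipticCurves.SatisfiesHeegnerHypothesis N K → Odd (NumberField.discr K) → (∀ Q : (W.baseChange K).toAffine.Point, (3 : ℕ) • Q = 0 → Q = 0) → ∀ (κ : Literature.NumberTheory.EllipticCurves.ZpExtension K 3), κ.IsAnticyclotomic → ∀ (γ : Field.absoluteGaloisGroup K) [Fact (κ.IsTopGenerator γ)] (𝔭 : IsDedekindDomain.HeightOneSpectrum (NumberField.RingOfIntegers K)), ((3 : ℕ) : NumberField.RingOfIntegers K) ∈ 𝔭.asIdeal → 𝔭.asIdeal.ramificationIdx (NumberField.RingOfIntegers ℚ) = 1 → 𝔭.asIdeal.inertiaDeg (NumberField.RingOfIntegers ℚ) = 1 → ∀ (𝔭' : IsDedekindDomain.HeightOneSpectrum (NumberField.RingOfIntegers K)), ((3 : ℕ) : NumberField.RingOfIntegers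 K) ∈ 𝔭'.asIdeal → 𝔭' ≠ 𝔭 → ∀ (θsub θquot : FramedGaloisRep K (padicCoeffIntegers (∅ : Set (PadicAlgCl 3))) 1), Literature.NumberTheory.EllipticCurves.KellerYin2024.IsResidualPairOver (W.baseChange K) 3 θsub θquot → ∀ (Sf : Finset (IsDedekindDomain.HeightOneSpectrum (NumberField.RingOfIntegers K))), (∀ w : IsDedekindDomain.HeightOneSpectrum (NumberField.RingOfIntegers K), w ∈ Sf ↔ ((W.conductorNorm ℤ : ℤ) : NumberField.RingOfIntegers K) ∈ w.asIdeal) → ∀ (Dsub : Literature.NumberTheory.EllipticCurves.GreenbergVatsal2000.DatumDualData κ γ (Literature.NumberTheory.EllipticCurves.KellerYin2024.charModule (∅ : Set (PadicAlgCl 3)) θsub) (Literature.NumberTheory.EllipticCurves.Castella2018.AcSelmer.bdpData (Literature.NumberTheory.EllipticCurves.KellerYin2024.charModule (∅ : Set (PadicAlgCl 3)) θsub) 3 𝔭') ∅) (Dquot : Literature.NumberTheory.EllipticCurves.GreenbergVatsal2000.DatumDualData κ γ (Literature.NumberTheory.EllipticCurves.KellerYin2024.charModule (∅ : Set (PadicAlgCl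 3)) θquot) (Literature.NumberTheory.EllipticCurves.Castella2018.AcSelmer.bdpData (Literature.NumberTheory.EllipticCurves.KellerYin2024.charModule (∅ : Set (PadicAlgCl 3)) θquot) 3 𝔭') ∅), Module.Finite (Literature.NumberTheory.EllipticCurves.IwasawaAlgebra 3) (Summit.BirchSwinnertonDyer.Rank1Residual.X11b.AcSelmer.XAc (W.baseChange K) 3 κ 𝔭' ∅ γ) ∧ Module.IsTorsion (Literature.NumberTheory.EllipticCurves.IwasawaAlgebra 3) (Summit.BirchSwinnertonDyer.Rank1Residual.X11b.AcSelmer.XAc (W.baseChange K) 3 κ 𝔭' ∅ γ) ∧ Literature.NumberTheory.EllipticCurves.muInvariant 3 (Summit.BirchSwinnertonDyer.Rank1Residual.X11b.AcSelmer.XAc (W.baseChange K) 3 κ 𝔭' ∅ γ) = 0 ∧ Literature.NumberTheory.EllipticCurves.lambdaInvariant 3 (Summit.BirchSwinnertonDyer.Rank1Residual.X11b.AcSelmer.XAc (W.baseChange K) 3 κ 𝔭' ∅ γ) + ∑ w ∈ Sf, Literature.NumberTheory.EllipticCurves.KellerYin2024.curveLocalLambda κ (W.baseChange K) w = Literature.NumberTheory.EllipticCurves.lambdaInvariant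 3 Dsub.X + Literature.NumberTheory.EllipticCurves.lambdaInvariant 3 Dquot.X + ∑ w ∈ Sf, (Literature.NumberTheory.EllipticCurves.KellerYin2024.charLocalLambda (∅ : Set (PadicAlgCl 3)) κ θsub w + Literature.NumberTheory.EllipticCurves.KellerYin2024.charLocalLambda (∅ : Set (PadicAlgCl 3)) κ θquot w))
    (han : ∀ (W : WeierstrassCurve ℚ) [W.IsElliptic] [W.IsGloballyMinimal] (N : ℕ) [NeZero N] (K : Type) [Field K] [NumberField K] (Dt : Literature.NumberTheory.EllipticCurves.ModularForms.ModularParametrizationData W N), Summit.BirchSwinnertonDyer.Rank1Residual.Additive.ClassO6 W 3 → Literature.NumberTheory.EllipticCurves.Rank1Residual.Red W 3 → (∃ Φ : AddSubgroup (WeierstrassCurve.geomTorsion W ((3 : ℕ) : ℤ)), Literature.NumberTheory.EllipticCurves.Rank1Residual.IsRationalLine W 3 Φ ∧ ∀ (v : IsDedekindDomain.HeightOneSpectrum (NumberField.RingOfIntegers ℚ)), ((3 : ℕ) : NumberField.RingOfIntegers ℚ) ∈ v.asIdeal → ∀ 𝔓 ∈ v.primesAbove, ¬ (∀ g ∈ 𝔓.decompositionSubgroup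 (Field.absoluteGaloisGroup ℚ), ∀ P ∈ Φ, g • P = P) ∧ ¬ (∀ g ∈ 𝔓.decompositionSubgroup (Field.absoluteGaloisGroup ℚ), ∀ P : WeierstrassCurve.geomTorsion W ((3 : ℕ) : ℤ), g • P - P ∈ Φ)) → W.analyticRank = 1 → W.conductorNorm ℤ = N → Literature.NumberTheory.EllipticCurves.IsImaginaryQuadratic K → Literature.NumberTheory.EllipticCurves.SatisfiesHeegnerHypothesis N K → Odd (NumberField.discr K) → ∀ (κ : Literature.NumberTheory.EllipticCurves.ZpExtension K 3), κ.IsAnticyclotomic → ∀ (γ : Field.absoluteGaloisGroup K) [Fact (κ.IsTopGenerator γ)] (𝔭 : IsDedekindDomain.HeightOneSpectrum (NumberField.RingOfIntegers K)), ((3 : ℕ) : NumberField.RingOfIntegers K) ∈ 𝔭.asIdeal → 𝔭.asIdeal.ramificationIdx (NumberField.RingOfIntegers ℚ) = 1 → 𝔭.asIdeal.inertiaDeg (NumberField.RingOfIntegers ℚ) = 1 → ∀ (𝔭' : IsDedekindDomain.HeightOneSpectrum (NumberField.RingOfIntegers K)), ((3 : ℕ) : NumberField.RingOfIntegers K) ∈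 𝔭'.asIdeal → 𝔭' ≠ 𝔭 → ∀ (ι' : PadicAlgCl 3 ≃+* ℂ), Summit.BirchSwinnertonDyer.BirchSwinnertonDyer.Theorems.SchneiderFree.BranchInducesPrime 3 ι' 𝔭 → ∀ (ΩK : ℂ) (Ωp : ℂ_[3]) (L : Literature.NumberTheory.EllipticCurves.UnrSeries 3), ΩK ≠ 0 → Ωp ≠ 0 → Literature.NumberTheory.EllipticCurves.IsBDPLFunction ι' 𝔭 κ γ Dt.f ΩK Ωp L → ∀ (θsub θquot : FramedGaloisRep ℚ (padicCoeffIntegers (∅ : Set (PadicAlgCl 3))) 1), Literature.NumberTheory.EllipticCurves.KellerYin2024.IsResidualPairOver (W.baseChange K) 3 (θsub.restrictField K) (θquot.restrictField K) → ∀ (θunr : FramedGaloisRep ℚ (padicCoeffIntegers (∅ : Set (PadicAlgCl 3))) 1), (θunr = θsub ∨ θunr = θquot) → (∀ u : IsDedekindDomain.HeightOneSpectrum (NumberField.RingOfIntegers ℚ), ((3 : ℕ) : NumberField.RingOfIntegers ℚ) ∈ u.asIdeal → θunr.IsUnramifiedAt u) → ∀ (Sf : Finset (IsDedekindDomain.HeightOneSpectrum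 (NumberField.RingOfIntegers K))), (∀ w : IsDedekindDomain.HeightOneSpectrum (NumberField.RingOfIntegers K), w ∈ Sf ↔ ((W.conductorNorm ℤ : ℤ) : NumberField.RingOfIntegers K) ∈ w.asIdeal) → ∀ (θK : HeckeCharacter K), Literature.NumberTheory.EllipticCurves.KellerYin2024.IsHeckeCharOf ι' (θunr.restrictField K) θK → ∀ (Cbar : Finset (IsDedekindDomain.HeightOneSpectrum (NumberField.RingOfIntegers K))), (∀ u ∈ Cbar, ¬ θK.IsUnramifiedAt u) → ∀ (ΩK' : ℂ) (Ωp' : (Literature.NumberTheory.EllipticCurves.unrIntegers 3)ˣ) (Lφ : Literature.NumberTheory.EllipticCurves.UnrSeries 3), ΩK' ≠ 0 → Literature.NumberTheory.EllipticCurves.CastellaGrossiLeeSkinner2022.IsKatzLFunction ι' 𝔭 𝔭' Cbar κ γ θK ΩK' ((Ωp' : Literature.NumberTheory.EllipticCurves.unrIntegers 3) : ℂ_[3]) Lφ → ∃ n nφ : ℕ, Literature.NumberTheory.EllipticCurves.KellerYin2024.FirstUnitCoeffAt L n ∧ Literature.NumberTheory.EllipticCurves.KellerYin2024.FirstUnitCoeffAt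 Lφ nφ ∧ n + ∑ w ∈ Sf, Literature.NumberTheory.EllipticCurves.KellerYin2024.curveLocalLambda κ (W.baseChange K) w = 2 * nφ + ∑ w ∈ Sf, (Literature.NumberTheory.EllipticCurves.KellerYin2024.charLocalLambda (∅ : Set (PadicAlgCl 3)) κ (θsub.restrictField K) w + Literature.NumberTheory.EllipticCurves.KellerYin2024.charLocalLambda (∅ : Set (PadicAlgCl 3)) κ (θquot.restrictField K) w))
    (hram : ∀ (W : WeierstrassCurve ℚ) [W.IsElliptic] [W.IsGloballyMinimal] (N : ℕ) [NeZero N] (K : Type) [Field K] [NumberField K], Summit.BirchSwinnertonDyer.Rank1Residual.Additive.ClassO6 W 3 → Literature.NumberTheory.EllipticCurves.Rank1Residual.Red W 3 → (∃ Φ : AddSubgroup (WeierstrassCurve.geomTorsion W ((3 : ℕ) : ℤ)), Literature.NumberTheory.EllipticCurves.Rank1Residual.IsRationalLine W 3 Φ ∧ ∀ (v : IsDedekindDomain.HeightOneSpectrum (NumberField.RingOfIntegers ℚ)), ((3 : ℕ) : NumberField.RingOfIntegers ℚ) ∈ v.asIdeal → ∀ 𝔓 ∈ v.primesAbove, ¬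 (∀ g ∈ 𝔓.decompositionSubgroup (Field.absoluteGaloisGroup ℚ), ∀ P ∈ Φ, g • P = P) ∧ ¬ (∀ g ∈ 𝔓.decompositionSubgroup (Field.absoluteGaloisGroup ℚ), ∀ P : WeierstrassCurve.geomTorsion W ((3 : ℕ) : ℤ), g • P - P ∈ Φ)) → W.conductorNorm ℤ = N → Literature.NumberTheory.EllipticCurves.IsImaginaryQuadratic K → Literature.NumberTheory.EllipticCurves.SatisfiesHeegnerHypothesis N K → Odd (NumberField.discr K) → (∀ Q : (W.baseChange K).toAffine.Point, (3 : ℕ) • Q = 0 → Q = 0) → ∀ (κ : Literature.NumberTheory.EllipticCurves.ZpExtension K 3), κ.IsAnticyclotomic → ∀ (γ : Field.absoluteGaloisGroup K) [Fact (κ.IsTopGenerator γ)] (𝔭 : IsDedekindDomain.HeightOneSpectrum (NumberField.RingOfIntegers K)), ((3 : ℕ) : NumberField.RingOfIntegers K) ∈ 𝔭.asIdeal → 𝔭.asIdeal.ramificationIdx (NumberField.RingOfIntegers ℚ) = 1 → 𝔭.asIdeal.inertiaDeg (NumberField.RingOfIntegers ℚ) = 1 → ∀ (𝔭' : IsDedekindDomain.HeightOneSpectrum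 (NumberField.RingOfIntegers K)), ((3 : ℕ) : NumberField.RingOfIntegers K) ∈ 𝔭'.asIdeal → 𝔭' ≠ 𝔭 → ∀ (ι' : PadicAlgCl 3 ≃+* ℂ), Summit.BirchSwinnertonDyer.BirchSwinnertonDyer.Theorems.SchneiderFree.BranchInducesPrime 3 ι' 𝔭 → ∀ (Φ : AddSubgroup (WeierstrassCurve.geomTorsion W ((3 : ℕ) : ℤ))), Literature.NumberTheory.EllipticCurves.Rank1Residual.IsRationalLine W 3 Φ → ∀ (θsub θquot : FramedGaloisRep ℚ (padicCoeffIntegers (∅ : Set (PadicAlgCl 3))) 1), Literature.NumberTheory.EllipticCurves.KellerYin2024.IsTeichmullerLiftOn (∅ : Set (PadicAlgCl 3)) (Φ.map (WeierstrassCurve.geomTorsion W ((3 : ℕ) : ℤ)).subtype) θsub → Literature.NumberTheory.EllipticCurves.KellerYin2024.IsTeichmullerLiftOnQuot (∅ : Set (PadicAlgCl 3)) (Φ.map (WeierstrassCurve.geomTorsion W ((3 : ℕ) : ℤ)).subtype) (WeierstrassCurve.geomTorsion W ((3 : ℕ) : ℤ)) θquot → ∀ (θunr θram : FramedGaloisRep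 ℚ (padicCoeffIntegers (∅ : Set (PadicAlgCl 3))) 1), ((θunr = θsub ∧ θram = θquot) ∨ (θunr = θquot ∧ θram = θsub)) → (∀ u : IsDedekindDomain.HeightOneSpectrum (NumberField.RingOfIntegers ℚ), ((3 : ℕ) : NumberField.RingOfIntegers ℚ) ∈ u.asIdeal → θunr.IsUnramifiedAt u) → ∀ (θK : HeckeCharacter K), Literature.NumberTheory.EllipticCurves.KellerYin2024.IsHeckeCharOf ι' (θunr.restrictField K) θK → ∀ (Cbar : Finset (IsDedekindDomain.HeightOneSpectrum (NumberField.RingOfIntegers K))), (∀ u ∈ Cbar, ¬ θK.IsUnramifiedAt u) → ∀ (ΩK' : ℂ) (Ωp' : (Literature.NumberTheory.EllipticCurves.unrIntegers 3)ˣ) (Lφ : Literature.NumberTheory.EllipticCurves.UnrSeries 3), ΩK' ≠ 0 → Literature.NumberTheory.EllipticCurves.CastellaGrossiLeeSkinner2022.IsKatzLFunction ι' 𝔭 𝔭' Cbar κ γ θK ΩK' ((Ωp' : Literature.NumberTheory.EllipticCurves.unrIntegers 3) : ℂ_[3]) Lφ → ∀ nφ : ℕ, Literature.NumberTheory.EllipticCurves.KellerYin2024.FirstUnitCoeffAt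 Lφ nφ → ∀ (Dram : Literature.NumberTheory.EllipticCurves.GreenbergVatsal2000.DatumDualData κ γ (Literature.NumberTheory.EllipticCurves.KellerYin2024.charModule (∅ : Set (PadicAlgCl 3)) (θram.restrictField K)) (Literature.NumberTheory.EllipticCurves.Castella2018.AcSelmer.bdpData (Literature.NumberTheory.EllipticCurves.KellerYin2024.charModule (∅ : Set (PadicAlgCl 3)) (θram.restrictField K)) 3 𝔭') ∅), Module.Finite (Literature.NumberTheory.EllipticCurves.IwasawaAlgebra 3) Dram.X ∧ Module.IsTorsion (Literature.NumberTheory.EllipticCurves.IwasawaAlgebra 3) Dram.X ∧ Literature.NumberTheory.EllipticCurves.muInvariant 3 Dram.X = 0 ∧ Literature.NumberTheory.EllipticCurves.lambdaInvariant 3 Dram.X = nφ)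
    (hbr : CharMainConjOnTree 3) (hF1 : KatzLFunctionExistsFor 3) :
    ∀ (W : WeierstrassCurve ℚ) [W.IsElliptic] [W.IsGloballyMinimal] (N : ℕ) [NeZero N] (K : Type) [Field K] [NumberField K] (Dt : Literature.NumberTheory.EllipticCurves.ModularForms.ModularParametrizationData W N), Summit.BirchSwinnertonDyer.Rank1Residual.Additive.ClassO6 W 3 → Literature.NumberTheory.EllipticCurves.Rank1Residual.Red W 3 → (∃ Φ : AddSubgroup (WeierstrassCurve.geomTorsion W ((3 : ℕ) : ℤ)), Literature.NumberTheory.EllipticCurves.Rank1Residual.IsRationalLine W 3 Φ ∧ ∀ (v : IsDedekindDomain.HeightOneSpectrum (NumberField.RingOfIntegers ℚ)), ((3 : ℕ) : NumberField.RingOfIntegers ℚ) ∈ v.asIdeal → ∀ 𝔓 ∈ v.primesAbove, ¬ (∀ g ∈ 𝔓.decompositionSubgroup (Field.absoluteGaloisGroup ℚ), ∀ P ∈ Φ, g • P = P) ∧ ¬ (∀ g ∈ 𝔓.decompositionSubgroup (Field.absoluteGaloisGroup ℚ), ∀ P : WeierstrassCurve.geomTorsion W ((3 : ℕ) : ℤ),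 g • P - P ∈ Φ)) → W.analyticRank = 1 → W.conductorNorm ℤ = N → Literature.NumberTheory.EllipticCurves.IsImaginaryQuadratic K → Literature.NumberTheory.EllipticCurves.SatisfiesHeegnerHypothesis N K → Odd (NumberField.discr K) → ∀ (κ : Literature.NumberTheory.EllipticCurves.ZpExtension K 3), κ.IsAnticyclotomic → ∀ (γ : Field.absoluteGaloisGroup K) [Fact (κ.IsTopGenerator γ)] (𝔭 : IsDedekindDomain.HeightOneSpectrum (NumberField.RingOfIntegers K)), ((3 : ℕ) : NumberField.RingOfIntegers K) ∈ 𝔭.asIdeal → 𝔭.asIdeal.ramificationIdx (NumberField.RingOfIntegers ℚ) = 1 → 𝔭.asIdeal.inertiaDeg (NumberField.RingOfIntegers ℚ) = 1 → ∀ (𝔭' : IsDedekindDomain.HeightOneSpectrum (NumberField.RingOfIntegers K)), ((3 : ℕ) : NumberField.RingOfIntegers K) ∈ 𝔭'.asIdeal → 𝔭' ≠ 𝔭 → ∀ (ι' : PadicAlgCl 3 ≃+* ℂ), Summit.BirchSwinnertonDyer.BirchSwinnertonDyer.Theorems.SchneiderFree.BranchInducesPrime 3 ι' 𝔭 → ∀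 (ΩK : ℂ) (Ωp : ℂ_[3]) (L : Literature.NumberTheory.EllipticCurves.UnrSeries 3), ΩK ≠ 0 → Ωp ≠ 0 → Literature.NumberTheory.EllipticCurves.IsBDPLFunction ι' 𝔭 κ γ Dt.f ΩK Ωp L → ∃ n : ℕ, n ≤ Literature.NumberTheory.EllipticCurves.lambdaInvariant 3 (Summit.BirchSwinnertonDyer.Rank1Residual.X11b.AcSelmer.XAc (W.baseChange K) 3 κ 𝔭' ∅ γ) ∧ ‖((PowerSeries.coeff n L : Literature.NumberTheory.EllipticCurves.unrIntegers 3) : ℂ_[3])‖ = 1 := by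
  intro W _ _ N _ K _ _ Dt hO6 hRed hcell hr hN hK hHN hodd κ hκ γ hγ 𝔭 h𝔭 he hf 𝔭' h𝔭' hne ι' hι ΩK Ωp L hΩK
    hΩp hBDP
  -- §0 frame data in the `bsd-eis` currency
  have hp : 2 < 3 := by norm_num
  have h3N : 3 ∣ W.conductorNorm ℤ :=
    (W.dvd_conductorNorm_iff_not_hasGoodReductionAtPrime 3).mpr (not_good_of_addv W 3 hO6.2.1)
  have hHW : SatisfiesHeegnerHypothesis (W.conductorNorm ℤ) K := by rw [hN]; exact hHN
  have hH3 : SatisfiesHeegnerHypothesis 3 K := SatisfiesHeegnerHypothesis.of_dvd h3N hHW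
  have hd3 : NumberField.discr K ≠ -3 := by
    intro h
    exact (X11b.Three.not_dvd_discr_and_not_dvd_torsionOrder_of_heegner hK hHW (p := 3) (by decide) h3N).1
      ⟨-1, by rw [h]; norm_num⟩
  have hv : ∀ x : 𝓞 K, x ∈ 𝔭.asIdeal ↔ ‖X11b.embAt K 3 𝔭 h𝔭 he hf (x : K)‖ < 1 :=
    X11b.mem_asIdeal_iff_norm_embAt_lt_one 𝔭 h𝔭 he hf
  have hι' : ∀ (w : InfinitePlace K) (k : 𝓞 K), k ∈ 𝔭.asIdeal ↔ ‖ι'.symm (w.embedding (k : K))‖ < 1 := hι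
  have hEK : ∀ Q : (W.baseChange K).toAffine.Point, (3 : ℕ) • Q = 0 → Q = 0 :=
    htor W N K hO6 hRed hcell hN hK hHN 𝔭 h𝔭 he hf
  -- §1 the Teichmüller pair of `G_ℚ`, its restriction to `Γ_K`, the places over `N`
  obtain ⟨Φ, hΦ, θsub, θquot, hsub, hquot⟩ := exists_teichmullerPair W 3 hRed
  have hpair : IsResidualPairOver (W.baseChange K) 3 (θsub.restrictField K) (θquot.restrictField K) :=
    isResidualPairOver_restrictField W 3 K hΦ hsub hquot
  obtain ⟨Sf, hSf⟩ := exists_finset_places_dvd (K := K) (N := W.conductorNorm ℤ) (W.conductorNorm_pos_holds).ne'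
  have hTs : ∀ σ : absoluteGaloisGroup ℚ, θsub σ ^ (3 - 1) = 1 := hsub.1
  have hTq : ∀ σ : absoluteGaloisGroup ℚ, θquot σ ^ (3 - 1) = 1 := hquot.1
  have hTsK : ∀ σ : absoluteGaloisGroup K, θsub.restrictField K σ ^ (3 - 1) = 1 := fun σ ↦ hTs _
  have hTqK : ∀ σ : absoluteGaloisGroup K, θquot.restrictField K σ ^ (3 - 1) = 1 := fun σ ↦ hTq _
  have hcardΦ : Nat.card (Φ.map (geomTorsion W ((3 : ℕ) : ℤ)).subtype) = 3 := by
    rw [Nat.card_congr (Φ.equivMapOfInjective (geomTorsion W ((3 : ℕ) : ℤ)).subtype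
      (geomTorsion W ((3 : ℕ) : ℤ)).subtype_injective).toEquiv.symm, hΦ.1]
  have hleΦ : Φ.map (geomTorsion W ((3 : ℕ) : ℤ)).subtype ≤ geomTorsion W ((3 : ℕ) : ℤ) := by
    rintro P ⟨Q, -, rfl⟩
    exact Q.2
  -- §2 Néron–Ogg–Shafarevich off `N` (note `3 ∣ N`, so `N ∉ u` forces `3 ∉ u`)
  have h3u : ∀ u : HeightOneSpectrum (𝓞 ℚ), ((W.conductorNorm ℤ : ℤ) : 𝓞 ℚ) ∉ u.asIdeal →
      ((3 : ℕ) : 𝓞 ℚ) ∉ u.asIdeal := by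
    intro u hu h3
    obtain ⟨c, hc⟩ := h3N
    exact hu (by rw [hc]; push_cast; exact u.asIdeal.mul_mem_right _ h3)
  have hunrN_sub : ∀ u : HeightOneSpectrum (𝓞 ℚ), ((W.conductorNorm ℤ : ℤ) : 𝓞 ℚ) ∉ u.asIdeal →
      θsub.IsUnramifiedAt u := fun u hu ↦
    isUnramifiedAt_of_isTeichmullerLiftOn W ∅ hcardΦ hleΦ hsub (hasGoodReductionAt_of_conductorNorm_notMem W u hu)
      (h3u u hu)
  have hunrN_quot : ∀ u : HeightOneSpectrum (𝓞 ℚ), ((W.conductorNorm ℤ : ℤ) : 𝓞 ℚ) ∉ u.asIdeal →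
      θquot.IsUnramifiedAt u := fun u hu ↦
    isUnramifiedAt_of_isTeichmullerLiftOnQuot W ∅ hcardΦ hquot (hasGoodReductionAt_of_conductorNorm_notMem W u hu)
      (h3u u hu)
  -- §3 the dual data of the two character Selmer groups (exist unconditionally)
  obtain ⟨Dsub⟩ := nonempty_unrDualData_char (∅ : Set (PadicAlgCl 3)) (θsub.restrictField K) κ 𝔭'
    (∅ : Set (HeightOneSpectrum (𝓞 K))) hγ.out
  obtain ⟨Dquot⟩ := nonempty_unrDualData_char (∅ : Set (PadicAlgCl 3)) (θquot.restrictField K) κ 𝔭'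
    (∅ : Set (HeightOneSpectrum (𝓞 K))) hγ.out
  -- §4 [ALG] (symmetric in the pair)
  obtain ⟨-, -, -, hXlam⟩ := halg W N K hO6 hRed hcell hN hK hHN hodd hEK κ hκ γ 𝔭 h𝔭 he hf 𝔭' h𝔭' hne
    (θsub.restrictField K) (θquot.restrictField K) hpair Sf hSf Dsub Dquot
  -- §5 case split on which member is unramified at `3` ([LOC₃])
  rcases hloc W hO6 hRed hcell Φ hΦ θsub θquot hsub hquot with hunr3 | hunr3
  · -- `θunr = θsub`, `θram = θquot`
    obtain ⟨θK, -, hθK'⟩ := exists_heckeCharacter_of_pow_eq_one ∅ ι' (θsub.restrictField K) hTsK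
    have hθK : IsHeckeCharOf ι' (θsub.restrictField K) θK := hθK'
    obtain ⟨ΩK₁, Ωp₁, L₁, hΩK₁, hL₁⟩ :=
      hF1 hp K hK hH3 hodd hd3 (X11b.embAt K 3 𝔭 h𝔭 he hf) 𝔭 𝔭' hv h𝔭' hne κ hκ γ ι' hι' θsub hTs
        (W.conductorNorm ℤ) hHW hunrN_sub hunr3 θK hθK
    have hCb : ∀ u ∈ (∅ : Finset (HeightOneSpectrum (𝓞 K))), ¬ θK.IsUnramifiedAt u := by simp
    -- [BR𝟙] at `θsub`
    obtain ⟨-, -, -, m₁, hm₁, hlam_unr⟩ := hbr hp K hK hH3 hodd hd3 (X11b.embAt K 3 𝔭 h𝔭 he hf) 𝔭 𝔭' hv h𝔭'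
      hne κ hκ γ ι' hι' θsub hTs (W.conductorNorm ℤ) hHW hunrN_sub hunr3 θK hθK Dsub ∅ hCb ΩK₁ Ωp₁ L₁ hΩK₁ hL₁
    -- [BRram] at `θquot`
    obtain ⟨-, -, -, hlam_ram⟩ := hram W N K hO6 hRed hcell hN hK hHN hodd hEK κ hκ γ 𝔭 h𝔭 he hf 𝔭' h𝔭' hne ι'
      hι Φ hΦ θsub θquot hsub hquot θsub θquot (Or.inl ⟨rfl, rfl⟩) hunr3 θK hθK ∅ hCb ΩK₁ Ωp₁ L₁ hΩK₁ hL₁ m₁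
      hm₁ Dquot
    -- [AN]
    obtain ⟨n, m₁', hn, hm₁', hsum⟩ := han W N K Dt hO6 hRed hcell hr hN hK hHN hodd κ hκ γ 𝔭 h𝔭 he hf 𝔭'
      h𝔭' hne ι' hι ΩK Ωp L hΩK hΩp hBDP θsub θquot hpair θsub (Or.inl rfl) hunr3 Sf hSf θK hθK ∅ hCb ΩK₁ Ωp₁
      L₁ hΩK₁ hL₁
    have hmm : m₁' = m₁ := hm₁'.unique hm₁
    subst hmm
    refine ⟨n, ?_, ((firstUnitCoeffAt_iff L n).mp hn).1⟩
    omega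
  · -- `θunr = θquot`, `θram = θsub`
    obtain ⟨θK, -, hθK'⟩ := exists_heckeCharacter_of_pow_eq_one ∅ ι' (θquot.restrictField K) hTqK
    have hθK : IsHeckeCharOf ι' (θquot.restrictField K) θK := hθK'
    obtain ⟨ΩK₁, Ωp₁, L₁, hΩK₁, hL₁⟩ :=
      hF1 hp K hK hH3 hodd hd3 (X11b.embAt K 3 𝔭 h𝔭 he hf) 𝔭 𝔭' hv h𝔭' hne κ hκ γ ι' hι' θquot hTq
        (W.conductorNorm ℤ) hHW hunrN_quot hunr3 θK hθK
    have hCb : ∀ u ∈ (∅ : Finset (HeightOneSpectrum (𝓞 K))), ¬ θK.IsUnramifiedAt u := by simp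
    -- [BR𝟙] at `θquot`
    obtain ⟨-, -, -, m₁, hm₁, hlam_unr⟩ := hbr hp K hK hH3 hodd hd3 (X11b.embAt K 3 𝔭 h𝔭 he hf) 𝔭 𝔭' hv h𝔭'
      hne κ hκ γ ι' hι' θquot hTq (W.conductorNorm ℤ) hHW hunrN_quot hunr3 θK hθK Dquot ∅ hCb ΩK₁ Ωp₁ L₁ hΩK₁ hL₁
    -- [BRram] at `θsub`
    obtain ⟨-, -, -, hlam_ram⟩ := hram W N K hO6 hRed hcell hN hK hHN hodd hEK κ hκ γ 𝔭 h𝔭 he hf 𝔭' h𝔭' hne ι'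
      hι Φ hΦ θsub θquot hsub hquot θquot θsub (Or.inr ⟨rfl, rfl⟩) hunr3 θK hθK ∅ hCb ΩK₁ Ωp₁ L₁ hΩK₁ hL₁ m₁
      hm₁ Dsub
    -- [AN]
    obtain ⟨n, m₁', hn, hm₁', hsum⟩ := han W N K Dt hO6 hRed hcell hr hN hK hHN hodd κ hκ γ 𝔭 h𝔭 he hf 𝔭'
      h𝔭' hne ι' hι ΩK Ωp L hΩK hΩp hBDP θsub θquot hpair θquot (Or.inr rfl) hunr3 Sf hSf θK hθK ∅ hCb ΩK₁ Ωp₁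
      L₁ hΩK₁ hL₁
    have hmm : m₁' = m₁ := hm₁'.unique hm₁
    subst hmm
    refine ⟨n, ?_, ((firstUnitCoeffAt_iff L n).mp hn).1⟩
    omega

end Summit.BirchSwinnertonDyer.BirchSwinnertonDyer.Theorems.EisensteinCharacterInvariantsAtThreeCharacterCut

end
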